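import Mathlib
import Literature.Barriers.ValiantsHypothesis.MonotoneGapParseTrees
import Summits.ValiantsHypothesis.ValiantsHypothesis.Theorems.PerDivisionHard.Negative.PlainBridge

/-!
# `DivisionGap.PerMultiplesHard` (stmt-ValiantsHypothesis-5068), line `typed-parse-tree-weights`:
stub `stub_pathWeightBound` — the measured, typed, path-telescoped Jerrum–Snir engine

For a single-typed target `g ∈ ℝ≥0[x_ij]` (all monomials of the same torus type
`τg = (row margins, column margins)`), a test measure `p ≥ 0` on exponent tables and a potential
`φ` on torus types with `φ 0 ≤ 0`, `φ (type xₑ) ≤ 0` and the jump constraint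
`(φ (τ₁ + τ₂) - max (φ τ₁) (φ τ₂)) · Σ_{A × B × C} p (a + b + c) ≤ 1` for every admissible typed
triple (`A` of type `τ₁`, `B` of type `τ₂`, `A + B + C ⊆ mon(g)`), one has
`(Σ_{m ∈ mon(g)} p m) · φ τg ≤ 2 · L(g)` (`stub_pathWeightBound`, the registered signature).

Proof (Jerrum–Snir, J. ACM 29 (1982), §3, measured by `p` and telescoped along ONE root-to-leaf
path of the parse tree), on the tree's circuit model through `gateVal` / `opVal` / `complSet` of
`MonotoneGapParseTrees.lean`.  `exists_gatePath` (strong induction on the gate index): with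
`S_i = Σ_{A_i × B_i × C_i} p (a + b + c')` the measured content of a binary product gate `i`
(operand monomial sets `A_i`, `B_i`, complement `C_i = complSet g mon(i)`), if `m ∈ mon(j)`,
`mon(j) + c ⊆ mon(g)` and `p (m + c) > 0` then some set `P` of binary product gates `≤ j` has
`ψ m ≤ Σ_{i ∈ P} 1 / S_i`, each `i ∈ P` producing `m + c` from a triple of `A_i × B_i × C_i`;
at a binary product gate `m = a + b` the cofactor lies in `C_j`, `S_j ≥ p (m + c) > 0`, the jump
inequality gives `ψ m ≤ max (ψ a) (ψ b) + 1 / S_j`, and the descent continues ONLY into the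
factor realising the max, the other factor joining the cofactor.  `sum_mul_le_prodCount` (double
counting, JS Thm. 3.3): `Σ_m p m · ψ m ≤ prodCount Q`, the monomials routed through gate `i`
carrying `p`-mass `≤ S_i` (they inject into `A_i × B_i × C_i`) — degree-blind, no multilinearity.
The stub: `ψ m = φ (type m)`, admissible triples are single-typed in `A`, `B` since `g` is and
types cancel, and `prodCount Q ≤ 2 · L(g)` by `exists_isMonotoneComputation_prodCount_le`.
-/

noncomputable section

-- `Summit.ValiantsHypothesis.ValiantsHypothesis.…` is the tree's mandated layout (Sub = Summit).
set_option linter.dupNamespace false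

namespace Summit.ValiantsHypothesis.ValiantsHypothesis.Theorems.DivisionGap.PerMultiplesHard.PathWeightBound

open Literature.Computability.AlgebraicComplexity MvPolynomial Finset
open Literature.Barriers.ValiantsHypothesis Literature.Barriers.ValiantsHypothesis.JerrumSnir
open ArithCircuit (Gate Operand)
open scoped NNReal Pointwise

variable {σ : Type*} [DecidableEq σ] {gs : List (Gate ℝ≥0 σ)} {g : MvPolynomial σ ℝ≥0}
  {p : (σ →₀ ℕ) → ℝ} {ψ : (σ →₀ ℕ) → ℝ} {S : ℕ → ℝ}

/-! ### The telescoped bound along one path of the parse tree (JS Thm. 3.4, path form) -/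

/-- Lifting the gate-level statement below `j` to operands read at position `j` (leaves — a
variable `x_e` or a constant, `ψ ≤ 0` — have empty path). [cite: JerrumSnir1982, Thm. 3.4] -/
theorem exists_opPath_of (h0 : ψ 0 ≤ 0) (h1 : ∀ e : σ, ψ (Finsupp.single e 1) ≤ 0) (j : ℕ)
    (ih : ∀ j' < j, ∀ m c : σ →₀ ℕ, m ∈ (gateVal gs j').support →
      (∀ x ∈ (gateVal gs j').support, x + c ∈ g.support) → 0 < p (m + c) →
        ∃ P : Finset ℕ, (∀ i ∈ P, i ≤ j') ∧ (ψ m ≤ ∑ i ∈ P, 1 / S i) ∧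
          ∀ i ∈ P, ∃ u v : Operand ℝ≥0 σ, gs[i]? = some (.prod [u, v]) ∧
            ∃ a ∈ (opVal gs i u).support, ∃ b ∈ (opVal gs i v).support,
              ∃ c' ∈ complSet g (gateVal gs i).support, a + b + c' = m + c)
    (u : Operand ℝ≥0 σ) (m c : σ →₀ ℕ) (hm : m ∈ (opVal gs j u).support)
    (hcof : ∀ x ∈ (opVal gs j u).support, x + c ∈ g.support) (hpos : 0 < p (m + c)) :
    ∃ P : Finset ℕ, (∀ i ∈ P, i < j) ∧ (ψ m ≤ ∑ i ∈ P, 1 / S i) ∧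
      ∀ i ∈ P, ∃ u' v' : Operand ℝ≥0 σ, gs[i]? = some (.prod [u', v']) ∧
        ∃ a ∈ (opVal gs i u').support, ∃ b ∈ (opVal gs i v').support,
          ∃ c' ∈ complSet g (gateVal gs i).support, a + b + c' = m + c := by
  cases u with
  | var e =>
    rw [opVal_var, support_X, Finset.mem_singleton] at hm
    subst hm
    exact ⟨∅, by simp, by rw [Finset.sum_empty]; exact h1 e, by simp⟩
  | const a =>
    have hm0 : m = 0 := by
      rw [opVal_const, C_apply, support_monomial] at hm
      split_ifs at hm with hc
      · simp at hm
      · simpa using hm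
    subst hm0
    exact ⟨∅, by simp, by rw [Finset.sum_empty]; exact h0, by simp⟩
  | gate j' =>
    by_cases hlt : j' < j
    · rw [opVal_gate, if_pos hlt] at hm hcof
      obtain ⟨P, hle, hb, hw⟩ := ih j' hlt m c hm hcof hpos
      exact ⟨P, fun i hi => lt_of_le_of_lt (hle i hi) hlt, hb, hw⟩
    · rw [opVal_gate, if_neg hlt] at hm
      simp at hm

/-- **PATH-BOUND and PATH-WITNESS** (Jerrum–Snir Thm. 3.3–3.4, measured by `p`, telescoped
along one path).  In a plain fan-in-two circuit over `ℝ≥0`, let `p ≥ 0`, `ψ 0 ≤ 0`, `ψ xₑ ≤ 0`,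
`S_i = Σ_{A_i × B_i × C_i} p` at binary product gates, and assume the jump inequality
`(ψ (a + b) - max (ψ a) (ψ b)) · Σ_{A × B × C} p (a' + b' + c') ≤ 1` whenever `A + B + C ⊆ mon(g)`,
`(a, b, c) ∈ A × B × C`.  If `m ∈ mon(j)`, `mon(j) + c ⊆ mon(g)`, `p (m + c) > 0`, some set `P`
of binary product gates `≤ j` has `ψ m ≤ Σ_{i ∈ P} 1 / S_i`, each `i ∈ P` producing `m + c`
from a triple of `A_i × B_i × C_i`. [cite: JerrumSnir1982, Thm. 3.3–3.4] -/
theorem exists_gatePath (hfan : ∀ g' ∈ gs, g'.fanIn ≤ 2) (hplain : ∀ g' ∈ gs, IsPlainGate g')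
    (hp : ∀ m, 0 ≤ p m) (h0 : ψ 0 ≤ 0) (h1 : ∀ e : σ, ψ (Finsupp.single e 1) ≤ 0)
    (hS : ∀ (i : ℕ) (u v : Operand ℝ≥0 σ), gs[i]? = some (.prod [u, v]) →
      S i = ∑ a ∈ (opVal gs i u).support, ∑ b ∈ (opVal gs i v).support,
        ∑ c ∈ complSet g (gateVal gs i).support, p (a + b + c))
    (hjump : ∀ (A B C : Finset (σ →₀ ℕ)), ∀ a ∈ A, ∀ b ∈ B, ∀ c ∈ C,
      (∀ a' ∈ A, ∀ b' ∈ B, ∀ c' ∈ C, a' + b' + c' ∈ g.support) →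
        (ψ (a + b) - max (ψ a) (ψ b)) *
          (∑ a' ∈ A, ∑ b' ∈ B, ∑ c' ∈ C, p (a' + b' + c')) ≤ 1) :
    ∀ j : ℕ, ∀ m c : σ →₀ ℕ, m ∈ (gateVal gs j).support →
      (∀ x ∈ (gateVal gs j).support, x + c ∈ g.support) → 0 < p (m + c) →
        ∃ P : Finset ℕ, (∀ i ∈ P, i ≤ j) ∧ (ψ m ≤ ∑ i ∈ P, 1 / S i) ∧
          ∀ i ∈ P, ∃ u v : Operand ℝ≥0 σ, gs[i]? = some (.prod [u, v]) ∧
            ∃ a ∈ (opVal gs i u).support, ∃ b ∈ (opVal gs i v).support,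
              ∃ c' ∈ complSet g (gateVal gs i).support, a + b + c' = m + c := by
  intro j
  induction j using Nat.strong_induction_on with
  | _ j ih =>
  intro m c hm hcof hpos
  have hop := exists_opPath_of (S := S) h0 h1 j ih
  -- passing `(m, c)` unchanged to an operand whose monomial set contains `mon`
  have hpass : ∀ u : Operand ℝ≥0 σ, m ∈ (opVal gs j u).support →
      (opVal gs j u).support ⊆ (gateVal gs j).support →
        ∃ P : Finset ℕ, (∀ i ∈ P, i ≤ j) ∧ (ψ m ≤ ∑ i ∈ P, 1 / S i) ∧
          ∀ i ∈ P, ∃ u v : Operand ℝ≥0 σ, gs[i]? = some (.prod [u, v]) ∧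
            ∃ a ∈ (opVal gs i u).support, ∃ b ∈ (opVal gs i v).support,
              ∃ c' ∈ complSet g (gateVal gs i).support, a + b + c' = m + c := by
    intro u hmu hsub
    obtain ⟨P, hlt, hb, hw⟩ := hop u m c hmu (fun x hx => hcof x (hsub hx)) hpos
    exact ⟨P, fun i hi => (hlt i hi).le, hb, hw⟩
  match hg : gs[j]? with
  | none => rw [gateVal_of_none gs hg] at hm; simp at hm
  | some (.sum args) =>
    have hpl : ∀ a ∈ args, a.1 = 1 :=
      (isPlainGate_sum_iff args).1 (hplain _ (List.mem_of_getElem? hg))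
    obtain ⟨a, ha, hma⟩ := exists_mem_of_mem_support_sum gs hg hm
    exact hpass a.2 hma (support_opVal_subset_sum gs hg hpl ha)
  | some (.prod []) =>
    rw [gateVal_prod_nil gs hg, support_one, Finset.mem_singleton] at hm
    subst hm
    exact ⟨∅, by simp, by rw [Finset.sum_empty]; exact h0, by simp⟩
  | some (.prod [u]) =>
    exact hpass u (by rwa [support_prod_one gs hg] at hm) (support_prod_one gs hg).symm.subset
  | some (.prod [u, v]) =>
    have hAB := support_prod_two gs hg
    obtain ⟨a, ha, b, hb, hsum⟩ := Finset.mem_add.1 (hAB ▸ hm)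
    -- the cofactor lies in the complement of the gate
    have hcC : c ∈ complSet g (gateVal gs j).support :=
      mem_complSet_of_mem hm fun x hx => by rw [add_comm]; exact hcof x hx
    -- the triple `(A_j, B_j, C_j)` is admissible
    have hABC : ∀ a' ∈ (opVal gs j u).support, ∀ b' ∈ (opVal gs j v).support,
        ∀ c' ∈ complSet g (gateVal gs j).support, a' + b' + c' ∈ g.support := by
      intro a' ha' b' hb' c' hc'
      have := (mem_complSet.1 hc').2 (a' + b') (by rw [hAB]; exact Finset.add_mem_add ha' hb')
      rwa [add_comm] at this
    have hJ := hjump _ _ _ _ ha _ hb _ hcC hABC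
    rw [← hS j u v hg] at hJ
    -- the measured content is at least `p (m + c) > 0`
    have hle : p (m + c) ≤ S j := by
      rw [hS j u v hg, ← hsum]
      refine le_trans ?_ (Finset.single_le_sum (f := fun a' => ∑ b' ∈ (opVal gs j v).support,
        ∑ c' ∈ complSet g (gateVal gs j).support, p (a' + b' + c'))
        (fun _ _ => Finset.sum_nonneg fun _ _ => Finset.sum_nonneg fun _ _ => hp _) ha)
      refine le_trans ?_ (Finset.single_le_sum
        (f := fun b' => ∑ c' ∈ complSet g (gateVal gs j).support, p (a + b' + c'))
        (fun _ _ => Finset.sum_nonneg fun _ _ => hp _) hb)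
      exact Finset.single_le_sum (f := fun c' => p (a + b + c')) (fun _ _ => hp _) hcC
    have hSpos : 0 < S j := lt_of_lt_of_le hpos hle
    have hstep : ψ m ≤ max (ψ a) (ψ b) + 1 / S j := by
      have := (le_div_iff₀ hSpos).2 hJ
      rw [hsum] at this
      linarith
    -- descend into the factor realising the max, absorbing the other factor into the cofactor
    have hdesc : ∀ (w : Operand ℝ≥0 σ) (x y : σ →₀ ℕ), x + y = m → max (ψ a) (ψ b) ≤ ψ x →
        x ∈ (opVal gs j w).support →
        (∀ x' ∈ (opVal gs j w).support, x' + y ∈ (gateVal gs j).support) →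
          ∃ P : Finset ℕ, (∀ i ∈ P, i ≤ j) ∧ (ψ m ≤ ∑ i ∈ P, 1 / S i) ∧
            ∀ i ∈ P, ∃ u v : Operand ℝ≥0 σ, gs[i]? = some (.prod [u, v]) ∧
              ∃ a ∈ (opVal gs i u).support, ∃ b ∈ (opVal gs i v).support,
                ∃ c' ∈ complSet g (gateVal gs i).support, a + b + c' = m + c := by
      intro w x y hxy hmax hx hxy'
      have heq : x + (c + y) = m + c := by rw [add_comm c, ← add_assoc, hxy]
      obtain ⟨P, hlt, hbd, hw⟩ := hop w x (c + y) hx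
        (fun x' hx' => by rw [add_comm c, ← add_assoc]; exact hcof _ (hxy' x' hx'))
        (by rw [heq]; exact hpos)
      have hnot : j ∉ P := fun h => lt_irrefl j (hlt j h)
      refine ⟨insert j P, ?_, ?_, ?_⟩
      · intro i hi
        rcases Finset.mem_insert.1 hi with rfl | hi
        · exact le_rfl
        · exact (hlt i hi).le
      · rw [Finset.sum_insert hnot]
        linarith
      · intro i hi
        rcases Finset.mem_insert.1 hi with rfl | hi
        · exact ⟨u, v, hg, a, ha, b, hb, c, hcC, by rw [hsum]⟩
        · rw [← heq]
          exact hw i hi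
    rcases le_total (ψ b) (ψ a) with hcmp | hcmp
    · exact hdesc u a b hsum (by rw [max_eq_left hcmp]) ha
        fun x' hx' => by rw [hAB]; exact Finset.add_mem_add hx' hb
    · exact hdesc v b a (by rw [add_comm, hsum]) (by rw [max_eq_right hcmp]) hb
        fun x' hx' => by rw [hAB, add_comm x']; exact Finset.add_mem_add ha hx'
  | some (.prod (u :: v :: w :: rest)) =>
    exfalso
    have := hfan _ (List.mem_of_getElem? hg)
    simp [Gate.fanIn, Gate.args] at this

/-! ### Double counting (JS Thm. 3.3, measured form) -/

/-- **The measured, path-telescoped Jerrum–Snir bound.**  For a monotone computation `Q` of `g`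
over `ℝ≥0`, a test function `p ≥ 0` and a potential `ψ` with `ψ 0 ≤ 0`, `ψ xₑ ≤ 0` satisfying the
jump inequality on admissible triples, `Σ_{m ∈ mon(g)} p m · ψ m ≤ prodCount Q`: bound each `ψ m`
(`p m > 0`) by `Σ_{i ∈ P_m} 1 / S_i` (`exists_gatePath` from the output), exchange the sums, and
note that the monomials routed through the product gate `i` inject into `A_i × B_i × C_i` via
their witness triples, so carry `p`-mass `≤ S_i`. [cite: JerrumSnir1982, Thm. 3.3 and Cor. 3.5] -/
theorem sum_mul_le_prodCount {Q : ArithCircuit ℝ≥0 σ} (hQ : IsMonotoneComputation Q g)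
    (hp : ∀ m, 0 ≤ p m) (ψ : (σ →₀ ℕ) → ℝ) (h0 : ψ 0 ≤ 0)
    (h1 : ∀ e : σ, ψ (Finsupp.single e 1) ≤ 0)
    (hjump : ∀ (A B C : Finset (σ →₀ ℕ)), ∀ a ∈ A, ∀ b ∈ B, ∀ c ∈ C,
      (∀ a' ∈ A, ∀ b' ∈ B, ∀ c' ∈ C, a' + b' + c' ∈ g.support) →
        (ψ (a + b) - max (ψ a) (ψ b)) *
          (∑ a' ∈ A, ∑ b' ∈ B, ∑ c' ∈ C, p (a' + b' + c')) ≤ 1) :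
    ∑ m ∈ g.support, p m * ψ m ≤ prodCount Q := by
  obtain ⟨hfan, hplain, hcomp⟩ := hQ
  set gs := Q.gates with hgs
  have hu : opVal gs gs.length Q.output = g := by rw [← eval_eq_opVal]; exact hcomp
  -- the measured contents `S_i` of the binary product gates (junk `0` elsewhere)
  obtain ⟨S, hS⟩ : ∃ S : ℕ → ℝ, ∀ (i : ℕ) (u v : Operand ℝ≥0 σ),
      gs[i]? = some (.prod [u, v]) →
        S i = ∑ a ∈ (opVal gs i u).support, ∑ b ∈ (opVal gs i v).support,
          ∑ c ∈ complSet g (gateVal gs i).support, p (a + b + c) := by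
    classical
    refine ⟨fun i => if h : ∃ uv : Operand ℝ≥0 σ × Operand ℝ≥0 σ,
        gs[i]? = some (.prod [uv.1, uv.2]) then
      ∑ a ∈ (opVal gs i h.choose.1).support, ∑ b ∈ (opVal gs i h.choose.2).support,
        ∑ c ∈ complSet g (gateVal gs i).support, p (a + b + c) else 0, ?_⟩
    intro i u v hi
    have hex : ∃ uv : Operand ℝ≥0 σ × Operand ℝ≥0 σ, gs[i]? = some (.prod [uv.1, uv.2]) :=
      ⟨(u, v), hi⟩
    have huv : hex.choose = (u, v) := by
      have h' := hi.symm.trans hex.choose_spec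
      simp only [Option.some.injEq, Gate.prod.injEq, List.cons.injEq, and_true] at h'
      exact Prod.ext h'.1.symm h'.2.symm
    simp only [dif_pos hex, huv]
  set I : Finset ℕ := (Finset.range gs.length).filter fun i => isProdAt gs i = true with hI
  obtain ⟨M, hMdef⟩ : ∃ M : Finset (σ →₀ ℕ), M = g.support.filter fun m => 0 < p m :=
    ⟨_, rfl⟩
  -- the root: every monomial of `g` descends from the output with cofactor `0`
  have hroot : ∀ m, ∃ P : Finset ℕ, m ∈ M → (∀ i ∈ P, i < gs.length) ∧
      (ψ m ≤ ∑ i ∈ P, 1 / S i) ∧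
      ∀ i ∈ P, ∃ u' v' : Operand ℝ≥0 σ, gs[i]? = some (.prod [u', v']) ∧
        ∃ a ∈ (opVal gs i u').support, ∃ b ∈ (opVal gs i v').support,
          ∃ c' ∈ complSet g (gateVal gs i).support, a + b + c' = m := by
    intro m
    by_cases hm : m ∈ M
    · obtain ⟨hmg, hpm⟩ := Finset.mem_filter.1 (hMdef ▸ hm)
      obtain ⟨P, hP⟩ := exists_opPath_of (S := S) h0 h1 gs.length
        (fun j' _ => exists_gatePath hfan hplain hp h0 h1 hS hjump j') Q.output m 0
        (by rw [hu]; exact hmg) (fun x hx => by rw [add_zero, ← hu]; exact hx)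
        (by rw [add_zero]; exact hpm)
      exact ⟨P, fun _ => by simpa only [add_zero] using hP⟩
    · exact ⟨∅, fun h => absurd h hm⟩
  choose P hP using hroot
  have hPI : ∀ m ∈ M, P m ⊆ I := by
    intro m hm i hi
    obtain ⟨u', v', hgi, -⟩ := (hP m hm).2.2 i hi
    exact Finset.mem_filter.2 ⟨Finset.mem_range.2 ((hP m hm).1 i hi), isProdAt_of_eq hgi⟩
  -- the fibre over a product gate carries `p`-mass at most `S_i`
  have hfib : ∀ i ∈ I, (∑ m ∈ M.filter (fun m => i ∈ P m), p m) * (1 / S i) ≤ 1 := by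
    intro i _
    rcases (M.filter fun m => i ∈ P m).eq_empty_or_nonempty with he | ⟨m₀, hm₀⟩
    · rw [he, Finset.sum_empty, zero_mul]
      exact zero_le_one
    obtain ⟨hm₀M, hi₀⟩ := Finset.mem_filter.1 hm₀
    obtain ⟨u, v, hgi, -⟩ := (hP m₀ hm₀M).2.2 i hi₀
    set T := (opVal gs i u).support ×ˢ ((opVal gs i v).support ×ˢ
      complSet g (gateVal gs i).support) with hT
    have hSi : S i = ∑ t ∈ T, p (t.1 + t.2.1 + t.2.2) := by
      rw [hS i u v hgi, hT, Finset.sum_product]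
      refine Finset.sum_congr rfl fun a _ => ?_
      rw [Finset.sum_product]
    have hsub : M.filter (fun m => i ∈ P m) ⊆ T.image fun t => t.1 + t.2.1 + t.2.2 := by
      intro m hm
      obtain ⟨hmM, hiP⟩ := Finset.mem_filter.1 hm
      obtain ⟨u', v', hgi', a, ha, b, hb, c', hc', hsum⟩ := (hP m hmM).2.2 i hiP
      have huv : u = u' ∧ v = v' := by
        have := hgi.symm.trans hgi'
        simpa using this
      obtain ⟨rfl, rfl⟩ := huv
      exact Finset.mem_image.2 ⟨(a, b, c'), by simp [hT, ha, hb, hc'], hsum⟩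
    have hmass : ∑ m ∈ M.filter (fun m => i ∈ P m), p m ≤ S i :=
      calc ∑ m ∈ M.filter (fun m => i ∈ P m), p m
          ≤ ∑ m ∈ T.image (fun t => t.1 + t.2.1 + t.2.2), p m :=
            Finset.sum_le_sum_of_subset_of_nonneg hsub fun _ _ _ => hp _
        _ ≤ ∑ t ∈ T, p (t.1 + t.2.1 + t.2.2) :=
            Finset.sum_image_le_of_nonneg fun _ _ => hp _
        _ = S i := hSi.symm
    have hS0 : 0 ≤ S i := by
      rw [hSi]
      exact Finset.sum_nonneg fun _ _ => hp _
    calc (∑ m ∈ M.filter (fun m => i ∈ P m), p m) * (1 / S i)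
        ≤ S i * (1 / S i) :=
          mul_le_mul_of_nonneg_right hmass (by rw [one_div]; exact inv_nonneg.2 hS0)
      _ = S i / S i := mul_one_div _ _
      _ ≤ 1 := div_self_le_one _
  have hcard : I.card = prodCount Q := by
    rw [hI, card_filter_isProdAt]
    rfl
  calc ∑ m ∈ g.support, p m * ψ m
      = ∑ m ∈ M, p m * ψ m := by
        rw [hMdef, Finset.sum_filter_of_ne]
        intro m _ hne
        exact lt_of_le_of_ne (hp m) fun h => hne (by rw [← h, zero_mul])
    _ ≤ ∑ m ∈ M, p m * ∑ i ∈ P m, 1 / S i :=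
        Finset.sum_le_sum fun m hm => mul_le_mul_of_nonneg_left (hP m hm).2.1 (hp m)
    _ = ∑ m ∈ M, ∑ i ∈ I, if i ∈ P m then p m * (1 / S i) else 0 := by
        refine Finset.sum_congr rfl fun m hm => ?_
        rw [Finset.mul_sum, Finset.sum_ite_mem, Finset.inter_eq_right.2 (hPI m hm)]
    _ = ∑ i ∈ I, ∑ m ∈ M, if i ∈ P m then p m * (1 / S i) else 0 := Finset.sum_comm
    _ = ∑ i ∈ I, (∑ m ∈ M.filter (fun m => i ∈ P m), p m) * (1 / S i) := by
        refine Finset.sum_congr rfl fun i _ => ?_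
        rw [Finset.sum_mul, ← Finset.sum_filter]
    _ ≤ ∑ i ∈ I, (1 : ℝ) := Finset.sum_le_sum hfib
    _ = (I.card : ℝ) := by simp
    _ = prodCount Q := by rw [hcard]

/-! ### Torus types and the stub -/

/-- Torus types `(row margins, column margins)` of exponent tables are additive. [folklore] -/
theorem torusType_add {n : ℕ} (x y : (Fin n × Fin n) →₀ ℕ) :
    ((Finsupp.mapDomain Prod.fst (x + y), Finsupp.mapDomain Prod.snd (x + y)) :
        (Fin n →₀ ℕ) × (Fin n →₀ ℕ)) =
      (Finsupp.mapDomain Prod.fst x, Finsupp.mapDomain Prod.snd x) +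
        (Finsupp.mapDomain Prod.fst y, Finsupp.mapDomain Prod.snd y) := by
  simp only [Finsupp.mapDomain_add, Prod.mk_add_mk]

/-- **S1 `stub_pathWeightBound`** (the engine of line `typed-parse-tree-weights`: Jerrum–Snir
Thm. 3.3–3.5 with degrees replaced by torus types, the recursion telescoped along the path of
larger potential, monomials weighted by a test measure `p ≥ 0`).  For a single-typed target `g`
over `ℝ≥0` (all monomials of torus type `τg`): if `φ` vanishes on leaves and
`(φ (τ₁ + τ₂) - max (φ τ₁) (φ τ₂)) · Σ_{A × B × C} p (a + b + c) ≤ 1` for every admissible typed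
triple, then `(Σ_{m ∈ mon(g)} p m) · φ τg ≤ 2 · L(g)` — `sum_mul_le_prodCount` for
`ψ m = φ (type m)` and a plain monotone computation `Q` of `g` with `prodCount Q ≤ 2 · L(g)`
(`exists_isMonotoneComputation_prodCount_le`). [cite: JerrumSnir1982, Thm. 3.3–3.5] -/
theorem stub_pathWeightBound :
    ∀ (n : ℕ) (g : MvPolynomial (Fin n × Fin n) NNReal) (τg : (Fin n →₀ ℕ) × (Fin n →₀ ℕ)),
      (∀ m ∈ g.support, (Finsupp.mapDomain Prod.fst m, Finsupp.mapDomain Prod.snd m) = τg) →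
      ∀ (p : ((Fin n × Fin n) →₀ ℕ) → ℝ), (∀ m, 0 ≤ p m) →
      ∀ (φ : (Fin n →₀ ℕ) × (Fin n →₀ ℕ) → ℝ), φ 0 ≤ 0 →
        (∀ e : Fin n × Fin n, φ (Finsupp.single e.1 1, Finsupp.single e.2 1) ≤ 0) →
        (∀ (A B C : Finset ((Fin n × Fin n) →₀ ℕ)) (τ₁ τ₂ : (Fin n →₀ ℕ) × (Fin n →₀ ℕ)),
          (∀ a ∈ A, (Finsupp.mapDomain Prod.fst a, Finsupp.mapDomain Prod.snd a) = τ₁) →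
          (∀ b ∈ B, (Finsupp.mapDomain Prod.fst b, Finsupp.mapDomain Prod.snd b) = τ₂) →
          (∀ a ∈ A, ∀ b ∈ B, ∀ c ∈ C, a + b + c ∈ g.support) →
          (φ (τ₁ + τ₂) - max (φ τ₁) (φ τ₂)) * (∑ a ∈ A, ∑ b ∈ B, ∑ c ∈ C, p (a + b + c)) ≤ 1) →
        (∑ m ∈ g.support, p m) * φ τg
          ≤ 2 * (Literature.Computability.AlgebraicComplexity.complexity g : ℝ) := by
  intro n g τg hτ p hp φ h0 h1 hcert
  obtain ⟨Q, hQ, hQc⟩ :=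
    Theorems.PerDivisionHardNegative.exists_isMonotoneComputation_prodCount_le g
  -- the potential on monomials: `ψ m = φ (type m)`
  obtain ⟨ψ, hψ⟩ : ∃ ψ : ((Fin n × Fin n) →₀ ℕ) → ℝ,
      ∀ m, ψ m = φ (Finsupp.mapDomain Prod.fst m, Finsupp.mapDomain Prod.snd m) :=
    ⟨_, fun _ => rfl⟩
  have hψ0 : ψ 0 ≤ 0 := by
    rw [hψ, Finsupp.mapDomain_zero, Finsupp.mapDomain_zero, Prod.mk_zero_zero]
    exact h0
  have hψ1 : ∀ e : Fin n × Fin n, ψ (Finsupp.single e 1) ≤ 0 := by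
    intro e
    rw [hψ, Finsupp.mapDomain_single, Finsupp.mapDomain_single]
    exact h1 e
  have hjump : ∀ (A B C : Finset ((Fin n × Fin n) →₀ ℕ)), ∀ a ∈ A, ∀ b ∈ B, ∀ c ∈ C,
      (∀ a' ∈ A, ∀ b' ∈ B, ∀ c' ∈ C, a' + b' + c' ∈ g.support) →
        (ψ (a + b) - max (ψ a) (ψ b)) *
          (∑ a' ∈ A, ∑ b' ∈ B, ∑ c' ∈ C, p (a' + b' + c')) ≤ 1 := by
    intro A B C a ha b hb c hc hABC
    -- `A` and `B` are single-typed, since `g` is and types cancel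
    have hA : ∀ a' ∈ A, (Finsupp.mapDomain Prod.fst a', Finsupp.mapDomain Prod.snd a') =
        (Finsupp.mapDomain Prod.fst a, Finsupp.mapDomain Prod.snd a) := by
      intro a' ha'
      have h1' := hτ _ (hABC a' ha' b hb c hc)
      rw [torusType_add, torusType_add, ← hτ _ (hABC a ha b hb c hc), torusType_add,
        torusType_add, add_assoc, add_assoc] at h1'
      exact add_right_cancel h1'
    have hB : ∀ b' ∈ B, (Finsupp.mapDomain Prod.fst b', Finsupp.mapDomain Prod.snd b') =
        (Finsupp.mapDomain Prod.fst b, Finsupp.mapDomain Prod.snd b) := by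
      intro b' hb'
      have h1' := hτ _ (hABC a ha b' hb' c hc)
      rw [torusType_add, torusType_add, ← hτ _ (hABC a ha b hb c hc), torusType_add,
        torusType_add, add_assoc, add_assoc] at h1'
      have h3 := add_left_cancel h1'
      exact add_right_cancel h3
    rw [hψ, hψ, hψ, torusType_add]
    exact hcert A B C _ _ hA hB hABC
  calc (∑ m ∈ g.support, p m) * φ τg = ∑ m ∈ g.support, p m * ψ m := by
        rw [Finset.sum_mul]
        refine Finset.sum_congr rfl fun m hm => ?_
        rw [hψ, hτ m hm]
    _ ≤ prodCount Q := sum_mul_le_prodCount hQ hp ψ hψ0 hψ1 hjump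
    _ ≤ 2 * (complexity g : ℝ) := by exact_mod_cast hQc

end Summit.ValiantsHypothesis.ValiantsHypothesis.Theorems.DivisionGap.PerMultiplesHard.PathWeightBound
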